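import Literature.AlgebraicGeometry.Deformation.SquareZeroExtensionObstruction
import HarnessLib

/-!
# The ideal module of `Z ⟶ Y₀ ≅ Y₁` is the push-forward of the ideal module of `Z ⟶ Y₀`

Layer `Literature/AlgebraicGeometry/Deformation` (companion of `SquareZeroExtensionObstruction.lean`,
which defines, for a morphism of schemes `i : Z ⟶ Y`, the structure map `structureModuleMap i :
𝒪_Y ⟶ i_*𝒪_Z` as a morphism of `𝒪_Y`-modules and the IDEAL MODULE `idealModule i = Ker(i♯)` with its
inclusion `idealModuleι i`). For an ISOMORPHISM of schemes `e : Y₀ ≅ Y₁` this file PROVES (no named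
facts):

* `structureModuleMap_comp` — `(i ≫ f)♯ = f♯ ≫ f_*(i♯)` up to Mathlib's `pushforwardComp`
  (by `rfl` on sections);
* `isIso_structureModuleMap_hom` — `e♯ : 𝒪_{Y₁} ⟶ e_*𝒪_{Y₀}` is an isomorphism;
* **`idealModulePushforwardIso i e : idealModule (i ≫ e.hom) ≅ e_* (idealModule i)`** — built from
  `kernel.lift` on both sides (`e_*` preserves kernels: Mathlib `PreservesKernel.iso`, `e_*` being a
  right adjoint), with the compatibility with the inclusions
  `idealModulePushforwardIso_hom_comp_ι : hom ≫ e_*(ι_i) = ι_{i≫e} ≫ e♯` and its sectionwise form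
  `idealModuleι_app_idealModulePushforwardIso_hom_app` (a section of `𝓘_{i≫e}` over `U`, read in
  `𝒪_{Y₁}(U)` and pulled back by `e♯`, is the corresponding section of `𝓘_i` over `e⁻¹U` read in
  `𝒪_{Y₀}(e⁻¹U)`).

Motivation (venture HSemireg, bridge (B1), residual gap (T), step W3(a)): Bloch's pairing
`Ωʲ ⟶ 𝓗om(𝓘, … 𝓗om(𝓘, Ωⁿ|_Z)…)` (`HodgeTheory/BlochSemiregularityMapReal.lean`) is built from the
ideal module `𝓘 = idealModule i` of the subscheme; transporting `IsBlochSemiregular` along an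
isomorphism of the ambient scheme needs `𝓘_{i ≫ e} ≅ e_*𝓘_i` compatibly with `ι` (this file), the
forms (`HodgeTheory/CotangentSheafComap`, `HodgeSheafComap`), the iterated `𝓗om` and the cohomology
(`Modules/PushforwardIsoCohomology`).

References: The Stacks project, Tag 08KY (thickenings; the ideal `𝓘 = Ker(i♯)` and the exact sequence
`0 → 𝓘 → 𝒪_{X'} → 𝒪_X → 0`) — the statements here are its functoriality along an isomorphism of the
ambient scheme (reading; typed weaker-or-equal). [StacksProject]
-/

noncomputable section

open CategoryTheory CategoryTheory.Limits AlgebraicGeometry Opposite TopologicalSpace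

universe u

namespace Literature.AlgebraicGeometry.Deformation

section IdealPushforward

variable {Z Y₀ Y₁ : Scheme.{u}} (i : Z ⟶ Y₀) (e : Y₀ ≅ Y₁)

/-- `(i ≫ e)♯ = e♯ ≫ e_*(i♯)`: the structure map of the composite `Z ⟶ Y₀ ⟶ Y₁`, as a morphism of
`𝒪_{Y₁}`-modules, is `e♯ : 𝒪_{Y₁} ⟶ e_*𝒪_{Y₀}` followed by the push-forward of `i♯ : 𝒪_{Y₀} ⟶ i_*𝒪_Z`
(up to the identification `e_* i_* = (i ≫ e)_*`, Mathlib's `pushforwardComp`). [cite: StacksProject, Tag 08KY (the ideal Ker(i♯); reading: functoriality along an isomorphism)] -/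
theorem structureModuleMap_comp (f : Y₀ ⟶ Y₁) :
    structureModuleMap (i ≫ f) ≫ ((Scheme.Modules.pushforwardComp i f).app (structureSheafModule Z)).inv =
      structureModuleMap f ≫ (Scheme.Modules.pushforward f).map (structureModuleMap i) := by
  refine Scheme.Modules.hom_ext _ _ fun U => ?_
  ext a
  rfl

/-- `e♯ : 𝒪_{Y₁} ⟶ e_*𝒪_{Y₀}` is an isomorphism of `𝒪_{Y₁}`-modules for an isomorphism `e`.
[cite: StacksProject, Tag 08KY (the ideal Ker(i♯); reading: functoriality along an isomorphism)] -/
instance isIso_structureModuleMap_hom : IsIso (structureModuleMap e.hom) := by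
  refine Scheme.Modules.Hom.isIso_iff_isIso_app.mpr fun U => ?_
  change IsIso ((forget₂ RingCat Ab).map ((forget₂ CommRingCat RingCat).map (e.hom.app U)))
  infer_instance

/-- The map `𝓘_{i ≫ e} ⟶ e_* 𝓘_i`: the kernel of `(i ≫ e)♯` maps to the (push-forward of the)
kernel of `i♯` through `e♯` (`e_*` preserves kernels). [cite: StacksProject, Tag 08KY (the ideal Ker(i♯); reading: functoriality along an isomorphism)] -/
def idealModulePushforwardHom :
    idealModule (i ≫ e.hom) ⟶ (Scheme.Modules.pushforward e.hom).obj (idealModule i) :=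
  kernel.lift ((Scheme.Modules.pushforward e.hom).map (structureModuleMap i))
      (idealModuleι (i ≫ e.hom) ≫ structureModuleMap e.hom) (by
        refine Scheme.Modules.hom_ext _ _ fun U => ?_
        ext a
        exact congrArg (fun φ => Scheme.Modules.Hom.app φ U a)
          (idealModuleι_comp_structureModuleMap (i ≫ e.hom))) ≫
    (PreservesKernel.iso (Scheme.Modules.pushforward e.hom) (structureModuleMap i)).inv

/-- Compatibility with the inclusions: `(𝓘_{i≫e} ⟶ e_*𝓘_i) ≫ e_*(ι_i) = ι_{i≫e} ≫ e♯`.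
[cite: StacksProject, Tag 08KY (the ideal Ker(i♯); reading: functoriality along an isomorphism)] -/
@[reassoc]
theorem idealModulePushforwardHom_comp_ι :
    idealModulePushforwardHom i e ≫ (Scheme.Modules.pushforward e.hom).map (idealModuleι i) =
      idealModuleι (i ≫ e.hom) ≫ structureModuleMap e.hom := by
  rw [idealModulePushforwardHom, Category.assoc, PreservesKernel.iso_inv_ι, kernel.lift_ι]

/-- The map `e_* 𝓘_i ⟶ 𝓘_{i ≫ e}`: `e_*(ι_i)` followed by `(e♯)⁻¹` lands in the kernel of `(i ≫ e)♯`.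
[cite: StacksProject, Tag 08KY (the ideal Ker(i♯); reading: functoriality along an isomorphism)] -/
def idealModulePushforwardInv :
    (Scheme.Modules.pushforward e.hom).obj (idealModule i) ⟶ idealModule (i ≫ e.hom) :=
  kernel.lift (structureModuleMap (i ≫ e.hom))
    ((Scheme.Modules.pushforward e.hom).map (idealModuleι i) ≫ inv (structureModuleMap e.hom)) (by
      -- `e_*(ι_i) ≫ (e♯)⁻¹ ≫ (i ≫ e)♯ = e_*(ι_i) ≫ (e♯)⁻¹ ≫ e♯ ≫ e_*(i♯) = e_*(ι_i ≫ i♯) = 0`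
      have hsq : structureModuleMap (i ≫ e.hom) =
          structureModuleMap e.hom ≫ (Scheme.Modules.pushforward e.hom).map (structureModuleMap i) ≫
            ((Scheme.Modules.pushforwardComp i e.hom).app (structureSheafModule Z)).hom := by
        refine Scheme.Modules.hom_ext _ _ fun U => ?_
        ext a
        rfl
      rw [hsq, Category.assoc, IsIso.inv_hom_id_assoc, ← CategoryTheory.Functor.map_comp_assoc,
        idealModuleι_comp_structureModuleMap, CategoryTheory.Functor.map_zero, zero_comp])

/-- Compatibility with the inclusions: `(e_*𝓘_i ⟶ 𝓘_{i≫e}) ≫ ι_{i≫e} = e_*(ι_i) ≫ (e♯)⁻¹`.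
[cite: StacksProject, Tag 08KY (the ideal Ker(i♯); reading: functoriality along an isomorphism)] -/
@[reassoc]
theorem idealModulePushforwardInv_comp_ι :
    idealModulePushforwardInv i e ≫ idealModuleι (i ≫ e.hom) =
      (Scheme.Modules.pushforward e.hom).map (idealModuleι i) ≫ inv (structureModuleMap e.hom) :=
  kernel.lift_ι _ _ _

/-- **`𝓘_{i ≫ e} ≅ e_* 𝓘_i`**: for a morphism `i : Z ⟶ Y₀` and an isomorphism `e : Y₀ ≅ Y₁` of
schemes, the ideal module (`Ker((i ≫ e)♯)`, the tree's `idealModule`) of the composite is the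
push-forward along `e` of the ideal module of `i`, compatibly with the inclusions into the structure
sheaves (`idealModulePushforwardIso_hom_comp_ι`). [cite: StacksProject, Tag 08KY (the ideal Ker(i♯); reading: functoriality along an isomorphism)] -/
def idealModulePushforwardIso :
    idealModule (i ≫ e.hom) ≅ (Scheme.Modules.pushforward e.hom).obj (idealModule i) where
  hom := idealModulePushforwardHom i e
  inv := idealModulePushforwardInv i e
  hom_inv_id := by
    rw [← cancel_mono (idealModuleι (i ≫ e.hom)), Category.assoc, idealModulePushforwardInv_comp_ι,
      idealModulePushforwardHom_comp_ι_assoc, IsIso.hom_inv_id, Category.comp_id, Category.id_comp]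
  inv_hom_id := by
    haveI : Mono ((PreservesKernel.iso (Scheme.Modules.pushforward e.hom) (structureModuleMap i)).hom ≫
        kernel.ι ((Scheme.Modules.pushforward e.hom).map (structureModuleMap i))) := mono_comp _ _
    rw [← cancel_mono ((PreservesKernel.iso (Scheme.Modules.pushforward e.hom)
        (structureModuleMap i)).hom ≫
      kernel.ι ((Scheme.Modules.pushforward e.hom).map (structureModuleMap i))),
      Category.id_comp, PreservesKernel.iso_hom, kernelComparison_comp_ι, Category.assoc,
      idealModulePushforwardHom_comp_ι, idealModulePushforwardInv_comp_ι_assoc, IsIso.inv_hom_id,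
      Category.comp_id]

/-- `(idealModulePushforwardIso i e).hom ≫ e_*(ι_i) = ι_{i≫e} ≫ e♯`. [cite: StacksProject, Tag 08KY (the ideal Ker(i♯); reading: functoriality along an isomorphism)] -/
@[reassoc]
theorem idealModulePushforwardIso_hom_comp_ι :
    (idealModulePushforwardIso i e).hom ≫ (Scheme.Modules.pushforward e.hom).map (idealModuleι i) =
      idealModuleι (i ≫ e.hom) ≫ structureModuleMap e.hom :=
  idealModulePushforwardHom_comp_ι i e

/-- On sections: for `a ∈ Γ(𝓘_{i≫e}, U)`, the section `(idealModulePushforwardIso i e).hom a` of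
`𝓘_i` over `e⁻¹U`, read in `𝒪_{Y₀}(e⁻¹U)`, is `e♯` of `a` read in `𝒪_{Y₁}(U)`.
[cite: StacksProject, Tag 08KY (the ideal Ker(i♯); reading: functoriality along an isomorphism)] -/
theorem idealModuleι_app_idealModulePushforwardIso_hom_app (U : Y₁.Opens)
    (a : Γ(idealModule (i ≫ e.hom), U)) :
    (idealModuleι i).app (e.hom ⁻¹ᵁ U) ((idealModulePushforwardIso i e).hom.app U a) =
      e.hom.app U ((idealModuleι (i ≫ e.hom)).app U a) := by
  exact congrArg (fun φ => Scheme.Modules.Hom.app φ U a) (idealModulePushforwardIso_hom_comp_ι i e)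

end IdealPushforward

end Literature.AlgebraicGeometry.Deformation

end
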